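import Mathlib
import HarnessLib
import Summits.HubbardSuperconductivity.HubbardSuperconductivity.Theorems.KLProgrammeKLRegimeEngineIsoTupleExportWBase

/-!
# Route `KLProgramme` — ENGINE item stmt-HubbardSuperconductivity-20437 `KLRegimeEngineV17F2`, the (X).2 conjunct
# `∃ e, IsIsoPkgW P CF e ∧ IsoTupleLineStepW P R Q e.1 e.2.1 e.2.2` (class #6): the K4 CLOSER MODULO ONE HYPOTHESIS — an outright iso line
# at the scales `n ≥ 1` (the producer (α) in ISO currency), composed with the landed scale-`0` package

Cell gate-hubbard-kl, seat hubbard-kl-k3c2-p2 (g10; class-#6 text owner).  Pen (R59v)(B)/(F): (X).2's TEXT is frozen (p556352 names; `CF := klEngGeo8.CF`,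
`Q := klEngQ9 P R`), its producer is the located risk (α), OWNER NONE before T.  ALPHA-PLAN.md (evidence on 20437) recommends that (α) land in ISO
currency — `IsoTupleLineAt L M a b P β U μ n` for `n ≥ 1` outright, under the W-Step's binders.  This file is the closer that then finishes (X).2:

* **`isoTupleLineStepW_of_isoLine`** — for ANY table `Q` and threshold `u`: an outright iso line `(a, b)` at every scale `1 ≤ n ≤ nScales β + 1` (the W-Step's
  binders; history, weighted data and earlier iso lines NOT needed) + the landed scale-`0` case (`isoTupleLineStepW_scaleZero_case`, package
  `(klIsoT⁴/2, klIsoT⁴·klScaleZeroValC R/192)`) ⟹ `IsoTupleLineStepW P R Q (max a (klIsoT⁴/2)) (max b (klIsoT⁴·klScaleZeroValC R/192)) u` (`IsoTupleLineAt.mono`);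
* **`exists_isoPkgW_of_isoLine`** — with `0 < u cc` and the FIT `max a (klIsoT⁴/2) + max b (klIsoT⁴·klScaleZeroValC R/192)·Klam²·(u cc) ≤ CF/2` at every `cc`:
  `∃ e, IsIsoPkgW P CF e ∧ IsoTupleLineStepW P R Q e.1 e.2.1 e.2.2` — the (X).2 conjunct at any `(CF, Q)`, hence at the frozen `(klEngGeo8.CF, klEngQ9 P R)`;
* `exists_isoPkgW_klEngGeo8_of_isoLine` — the fit discharged at `CF := klEngGeo8.CF` for a line with `klIsoT⁴/2 ≤ a ≤ 2^26·klIsoT⁴`,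
  `klIsoT⁴·klScaleZeroValC R/192 ≤ b` and a producer-chosen threshold with `b·Klam²·u cc ≤ 2^26·klIsoT⁴`: the room `2^28·klIsoT⁴ ≤ klEngGeo8.CF`
  (`two_pow_mul_klIsoT_pow_four_le_klEngGeo8_CF`) pays for both — the n = 0 base's arithmetic, as ALPHA-PLAN §1 says.

So the (X).2 residual is LITERALLY one ∀-statement (the hypothesis `hline` below).  Everything is proved; no definitions; nothing about the model is asserted
beyond these implications.
-/

noncomputable section

namespace Summit.HubbardSuperconductivity.HubbardSuperconductivity.Theorems.KLRegimeSplit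

set_option linter.dupNamespace false -- summit = problem name (single-conjunct summit), D-0017

open Real Finset Literature.MathematicalPhysics.QuantumLattice Literature.Probability.LatticeModels
open Summit.HubbardSuperconductivity.HubbardSuperconductivity.Theorems.KLProgrammeLegKernels
open Summit.HubbardSuperconductivity.HubbardSuperconductivity.Theorems.DispersionFlow
open Summit.HubbardSuperconductivity.HubbardSuperconductivity.Theorems.EngineV8

/-- **The W-Step from an outright iso line at the scales `n ≥ 1`** (any table `Q`, any threshold `u`): if under the W-Step's binders every scale
`1 ≤ n ≤ nScales β + 1` has `IsoTupleLineAt L M a b P β U μ n`, then `IsoTupleLineStepW P R Q (max a (klIsoT⁴/2)) (max b (klIsoT⁴·klScaleZeroValC R/192)) u`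
(`n = 0`: the landed scale-`0` package `isoTupleLineStepW_scaleZero_case`; history / weighted data / earlier iso lines are not read). -/
theorem isoTupleLineStepW_of_isoLine (P : SplitConsts) (R : RenConsts) (hP : P.WF) (hR : R.WF2) (Q : EngConsts) {a b : ℝ} (u : ℝ → ℝ)
    (hline : ∀ cc : ℝ, 0 < cc → cc ≤ klEngC₃6 P R → ∀ μ ∈ klWindowC, ∀ U : ℝ, 0 < U → U ≤ klEngU₀10 P R cc → U ≤ u cc →
      ∀ β : ℝ, klBetaMin ≤ β → β ≤ Real.exp (cc / U ^ 2) → ∀ (L M : ℕ) [NeZero L] [NeZero M], klEngL₄ P R β U ≤ L → klEngM₃ β U L ≤ M →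
      ∀ n : ℕ, 1 ≤ n → n ≤ nScales β + 1 → IsKLRegime U cc (-(n : ℤ)) → FrameOK R U (nScales β) μ (klFlowFrameU L M β U μ n) →
      IsoTupleLineAt L M a b P β U μ n) :
    IsoTupleLineStepW P R Q (max a (klIsoT ^ 4 / 2)) (max b (klIsoT ^ 4 * klScaleZeroValC R / 192)) u := by
  intro G _ cc hcc hcc6 μ hμ U hU hU10 hUu β hβ hβc L M _ _ hL hM n hn hreg _ hK _ _
  rcases Nat.eq_zero_or_pos n with h0 | hpos
  · subst h0
    exact (isoTupleLineStepW_scaleZero_case P R hP hR hcc hcc6 hμ hU hU10 hβ hβc hL hM hK).mono hU.le (le_max_right _ _) (le_max_right _ _)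
  · exact (hline cc hcc hcc6 μ hμ U hU hU10 hUu β hβ hβc L M hL hM n hpos hn hreg hK).mono hU.le (le_max_left _ _) (le_max_left _ _)

/-- **The (X).2 conjunct from an outright iso line + the fit** (any `CF`, any `Q`): with `0 < u cc` and
`max a (klIsoT⁴/2) + max b (klIsoT⁴·klScaleZeroValC R/192)·Klam²·(u cc) ≤ CF/2` at every `cc`, and `0 ≤ a`-or-not (the maxima are nonnegative anyway under `R.WF2`):
`∃ e, IsIsoPkgW P CF e ∧ IsoTupleLineStepW P R Q e.1 e.2.1 e.2.2`. -/
theorem exists_isoPkgW_of_isoLine (P : SplitConsts) (R : RenConsts) (hP : P.WF) (hR : R.WF2) (Q : EngConsts) {CF a b : ℝ} {u : ℝ → ℝ}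
    (hupos : ∀ cc, 0 < u cc)
    (hfit : ∀ cc, max a (klIsoT ^ 4 / 2) + max b (klIsoT ^ 4 * klScaleZeroValC R / 192) * P.Klam ^ 2 * u cc ≤ CF / 2)
    (hline : ∀ cc : ℝ, 0 < cc → cc ≤ klEngC₃6 P R → ∀ μ ∈ klWindowC, ∀ U : ℝ, 0 < U → U ≤ klEngU₀10 P R cc → U ≤ u cc →
      ∀ β : ℝ, klBetaMin ≤ β → β ≤ Real.exp (cc / U ^ 2) → ∀ (L M : ℕ) [NeZero L] [NeZero M], klEngL₄ P R β U ≤ L → klEngM₃ β U L ≤ M →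
      ∀ n : ℕ, 1 ≤ n → n ≤ nScales β + 1 → IsKLRegime U cc (-(n : ℤ)) → FrameOK R U (nScales β) μ (klFlowFrameU L M β U μ n) →
      IsoTupleLineAt L M a b P β U μ n) :
    ∃ e : ℝ × ℝ × (ℝ → ℝ), IsIsoPkgW P CF e ∧ IsoTupleLineStepW P R Q e.1 e.2.1 e.2.2 := by
  have hT4 : 0 ≤ klIsoT ^ 4 := pow_nonneg klIsoT_nonneg 4
  have hV0 : 0 ≤ klScaleZeroValC R := (klScaleZeroValC_pos (gfr_nonneg_of_wf2 hR 0)).le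
  refine ⟨(max a (klIsoT ^ 4 / 2), max b (klIsoT ^ 4 * klScaleZeroValC R / 192), u), ⟨?_, ?_, fun cc => ⟨hupos cc, hfit cc⟩⟩,
    isoTupleLineStepW_of_isoLine P R hP hR Q u hline⟩
  · exact le_max_of_le_right (by positivity)
  · exact le_max_of_le_right (by positivity)

/-- **The (X).2 conjunct at the frozen `CF := klEngGeo8.CF` from an iso line in the n = 0 base's arithmetic** (any `Q`): if (α) delivers
`IsoTupleLineAt L M a b P β U μ n` at every `n ≥ 1` under a threshold `u` of its choice (`0 < u cc`, `b·Klam²·u cc ≤ 2^26·klIsoT⁴`), with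
`klIsoT⁴/2 ≤ a ≤ 2^26·klIsoT⁴` and `klIsoT⁴·klScaleZeroValC R/192 ≤ b`, then the (X).2 conjunct holds at `(klEngGeo8.CF, Q)` — the room
`2^28·klIsoT⁴ ≤ klEngGeo8.CF` (`two_pow_mul_klIsoT_pow_four_le_klEngGeo8_CF`) pays for both terms. -/
theorem exists_isoPkgW_klEngGeo8_of_isoLine (P : SplitConsts) (R : RenConsts) (hP : P.WF) (hR : R.WF2) (Q : EngConsts) {a b : ℝ} {u : ℝ → ℝ}
    (ha : klIsoT ^ 4 / 2 ≤ a) (ha' : a ≤ 2 ^ 26 * klIsoT ^ 4) (hb : klIsoT ^ 4 * klScaleZeroValC R / 192 ≤ b)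
    (hupos : ∀ cc, 0 < u cc) (hbu : ∀ cc, b * P.Klam ^ 2 * u cc ≤ 2 ^ 26 * klIsoT ^ 4)
    (hline : ∀ cc : ℝ, 0 < cc → cc ≤ klEngC₃6 P R → ∀ μ ∈ klWindowC, ∀ U : ℝ, 0 < U → U ≤ klEngU₀10 P R cc → U ≤ u cc →
      ∀ β : ℝ, klBetaMin ≤ β → β ≤ Real.exp (cc / U ^ 2) → ∀ (L M : ℕ) [NeZero L] [NeZero M], klEngL₄ P R β U ≤ L → klEngM₃ β U L ≤ M →
      ∀ n : ℕ, 1 ≤ n → n ≤ nScales β + 1 → IsKLRegime U cc (-(n : ℤ)) → FrameOK R U (nScales β) μ (klFlowFrameU L M β U μ n) →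
      IsoTupleLineAt L M a b P β U μ n) :
    ∃ e : ℝ × ℝ × (ℝ → ℝ), IsIsoPkgW P klEngGeo8.CF e ∧ IsoTupleLineStepW P R Q e.1 e.2.1 e.2.2 := by
  have hCF := two_pow_mul_klIsoT_pow_four_le_klEngGeo8_CF
  have hmaxa : max a (klIsoT ^ 4 / 2) = a := max_eq_left ha
  have hmaxb : max b (klIsoT ^ 4 * klScaleZeroValC R / 192) = b := max_eq_left hb
  refine exists_isoPkgW_of_isoLine P R hP hR Q hupos (fun cc => ?_) hline
  rw [hmaxa, hmaxb]
  have h := hbu cc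
  nlinarith

end Summit.HubbardSuperconductivity.HubbardSuperconductivity.Theorems.KLRegimeSplit

end
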